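import Summits.BirchSwinnertonDyer.BirchSwinnertonDyer.Theorems.ByReductionTypeAtTwoMultTransportRealHalving
import Literature.NumberTheory.EllipticCurves.LambdaInvariantCongruenceTransportAtTwo
import Mathlib.NumberTheory.NumberField.Completion.InfinitePlace
import Mathlib.NumberTheory.NumberField.InfinitePlace.TotallyRealComplex
import HarnessLib

/-!
# T-42-mult in the kernel, Stage B III-a: `Δ_E > 0` — the three real `2`-torsion abscissae
# `e₁ > e₂ > e₃`, Greenberg's "minimal `x`" dictionary, and real halving in `E(ℚ_w)`

Cell `bsd-2adic` (run/shared/lean/pub/bsd-2adic/), seat `bsd-2adic-t42` (BRIEF-T42, DESIGN-T42 §5 item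
K-arch1). HONEST FRAMING: research route; theorems only (no `def`, no named fact, nothing booked).

For `E/ℚ` with a rational point `P = (x, y)` of order `2` and `Δ_E > 0` the `2`-division cubic
`4X³ + b₂X² + 2b₄X + b₆` has three real roots `e₁ > e₂ > e₃` (one of them `x`):
* `exists_ordered_splitTwoTorsion_real` — over `ℝ`: the cubic is `4(X − x)(X² + βX + γ)` and
  `Δ = 16 (x² + βx + γ)² (β² − 4γ)`, so `β² − 4γ > 0`;
* `twoTorsionOdd_iff_eq_e₃` — Greenberg's predicate "`Φ = ⟨P⟩` is odd" (`TwoTorsionOdd W x`: `x` is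
  the least real root, i.e. `P` generates `C_∞[2]`, LNM 1716 p. 174) reads `x = e₃`;
* `exists_ordered_splitTwoTorsion_completion` — the same three roots in the completion `ℚ_w ≅ ℝ`
  at the infinite place `w` (`Completion.ringEquivRealOfIsReal`), with a square root of
  `(e₃ − e₁)(e₃ − e₂) > 0` in `ℚ_w`, the abscissa dictionary, and REAL HALVING in `E(ℚ_w)`: every
  `P ∈ E(ℚ_w)` is `2ᵏQ` or `2ᵏQ + T₃`, while `T₃ = (e₃, ·) ∉ 2E(ℚ_w)` (file III, transported along
  `E(ℚ_w) ≅ E(ℝ)`).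
These are the inputs of the archimedean local analysis of file III-b (`H¹(ℚ_w, E[2^∞])` versus
`H¹(ℚ_w, E)`; `C_∞[2] = ⟨T₃⟩`).

References: [GreenbergLNM1716] §5 p. 168, Remark p. 174; [Matsuno2008] Lemma 2.5, Prop. 4.4;
[SilvermanAEC2009] III.1, Prop. X.1.4; [MilneADT2006] I Rem. 3.7.
-/

set_option autoImplicit false

set_option linter.dupNamespace false

noncomputable section

open scoped Classical

universe u

namespace Summit.BirchSwinnertonDyer.BirchSwinnertonDyer.Theorems.MultTransportAtTwo

open NumberField WeierstrassCurve WeierstrassCurve.Affine WeierstrassCurve.Affine.Point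
  Literature.NumberTheory.EllipticCurves Literature.NumberTheory.EllipticCurves.Greenberg1999

/-! ## §1. The split cubic -/

section Cubic

variable {F : Type*} [Field F] [CharZero F] {V : Affine F} {e₁ e₂ e₃ : F}

omit [CharZero F] in
/-- Under `SplitTwoTorsion` the `2`-division cubic factors: `4r³ + b₂r² + 2b₄r + b₆ = 4(r−e₁)(r−e₂)(r−e₃)`.
[cite: SilvermanAEC2009, Prop. X.1.4] -/
theorem fourCubic_eq_of_splitTwoTorsion (h : V.SplitTwoTorsion e₁ e₂ e₃) (r : F) :
    4 * r ^ 3 + V.b₂ * r ^ 2 + 2 * V.b₄ * r + V.b₆ = 4 * ((r - e₁) * (r - e₂) * (r - e₃)) := by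
  rw [h.b₂_eq, h.b₄_eq, h.b₆_eq]; ring

/-- Under `SplitTwoTorsion` the real roots of the `2`-division cubic are exactly `e₁, e₂, e₃`.
[cite: SilvermanAEC2009, Prop. X.1.4] -/
theorem eq_or_eq_or_eq_of_root (h : V.SplitTwoTorsion e₁ e₂ e₃) {r : F}
    (hr : 4 * r ^ 3 + V.b₂ * r ^ 2 + 2 * V.b₄ * r + V.b₆ = 0) : r = e₁ ∨ r = e₂ ∨ r = e₃ := by
  rw [fourCubic_eq_of_splitTwoTorsion h, mul_eq_zero, mul_eq_zero, mul_eq_zero] at hr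
  rcases hr with h4 | (⟨h1 | h2⟩ | h3)
  · norm_num at h4
  · exact Or.inl (sub_eq_zero.mp h1)
  · exact Or.inr (Or.inl (sub_eq_zero.mp h2))
  · exact Or.inr (Or.inr (sub_eq_zero.mp h3))

omit [CharZero F] in
/-- `eᵢ` is a root of the split cubic. [cite: SilvermanAEC2009, Prop. X.1.4] -/
theorem root_of_splitTwoTorsion (h : V.SplitTwoTorsion e₁ e₂ e₃) :
    4 * e₃ ^ 3 + V.b₂ * e₃ ^ 2 + 2 * V.b₄ * e₃ + V.b₆ = 0 := by
  rw [fourCubic_eq_of_splitTwoTorsion h]; ring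

end Cubic

/-! ## §2. `Δ > 0` and one rational root: three ordered real roots -/

section RealRoots

/-- **Three ordered real roots.** For a Weierstrass curve `V/ℝ` with `Δ > 0` and a real root `x` of
the `2`-division cubic, the cubic splits as `4(X − e₁)(X − e₂)(X − e₃)` with `e₁ > e₂ > e₃` real and
`x ∈ {e₁, e₂, e₃}`: writing `4X³ + b₂X² + 2b₄X + b₆ = 4(X − x)(X² + βX + γ)`, one has
`Δ = 16(x² + βx + γ)²(β² − 4γ)`, so `β² − 4γ > 0` (Silverman *AEC* III.1: the discriminant of the
`2`-division cubic is `16Δ`). [cite: SilvermanAEC2009, III.1 and Prop. X.1.4] -/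
theorem exists_ordered_splitTwoTorsion_real (V : WeierstrassCurve ℝ) {x : ℝ}
    (hx : 4 * x ^ 3 + V.b₂ * x ^ 2 + 2 * V.b₄ * x + V.b₆ = 0) (hΔ : 0 < V.Δ) :
    ∃ e₁ e₂ e₃ : ℝ, e₃ < e₂ ∧ e₂ < e₁ ∧ V.toAffine.SplitTwoTorsion e₁ e₂ e₃ ∧
      (x = e₁ ∨ x = e₂ ∨ x = e₃) := by
  set β : ℝ := x + V.b₂ / 4 with hβ
  set γ : ℝ := V.b₄ / 2 + x * β with hγ
  set D : ℝ := β ^ 2 - 4 * γ with hD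
  set m : ℝ := x ^ 2 + β * x + γ with hm
  have hb₂ : V.b₂ = 4 * (β - x) := by rw [hβ]; ring
  have hb₄ : V.b₄ = 2 * (γ - x * β) := by rw [hγ]; ring
  have hb₆ : V.b₆ = -4 * x * γ := by rw [hγ, hβ]; linear_combination hx
  have hΔ4 : 4 * V.Δ = -V.b₂ ^ 2 * (V.b₂ * V.b₆ - V.b₄ ^ 2) - 32 * V.b₄ ^ 3 - 108 * V.b₆ ^ 2 +
      36 * V.b₂ * V.b₄ * V.b₆ := by
    rw [WeierstrassCurve.Δ]
    linear_combination (-V.b₂ ^ 2) * V.b_relation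
  rw [hb₂, hb₄, hb₆] at hΔ4
  have hΔ' : V.Δ = 16 * m ^ 2 * D := by
    rw [hm, hD]; linear_combination (1 / 4 : ℝ) * hΔ4
  have hDpos : 0 < D := by
    by_contra hle
    rw [not_lt] at hle
    have : 16 * m ^ 2 * D ≤ 0 := mul_nonpos_of_nonneg_of_nonpos (by positivity) hle
    linarith
  set r : ℝ := Real.sqrt D with hr
  have hr2 : r ^ 2 = D := Real.sq_sqrt hDpos.le
  have hr0 : 0 < r := Real.sqrt_pos.mpr hDpos
  set u : ℝ := (-β + r) / 2 with hu
  set v : ℝ := (-β - r) / 2 with hv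
  have hvu : v < u := by rw [hu, hv]; linarith
  have h0 : V.toAffine.SplitTwoTorsion x u v := by
    refine ⟨?_, ?_, ?_⟩
    · change V.b₂ = _
      rw [hb₂, hu, hv]; ring
    · change V.b₄ = _
      rw [hb₄, hu, hv]; linear_combination ((1 : ℝ) / 2) * hr2
    · change V.b₆ = _
      rw [hb₆, hu, hv]; linear_combination (-x) * hr2
  have hm0 : m ≠ 0 := by
    intro h0m
    rw [h0m] at hΔ'
    have : V.Δ = 0 := by rw [hΔ']; ring
    linarith
  have hxuv : (x - u) * (x - v) = m := by rw [hu, hv, hm]; linear_combination (-(1 : ℝ) / 4) * hr2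
  have hxu : x ≠ u := fun h ↦ hm0 (by rw [← hxuv, h, sub_self, zero_mul])
  have hxv : x ≠ v := fun h ↦ hm0 (by rw [← hxuv, h, sub_self, mul_zero])
  rcases lt_or_gt_of_ne hxv with hlt | hgt
  · -- `x < v < u`
    exact ⟨u, v, x, hlt, hvu, h0.swap₁₂.swap₂₃, Or.inr (Or.inr rfl)⟩
  · rcases lt_or_gt_of_ne hxu with hlt' | hgt'
    · -- `v < x < u`
      exact ⟨u, x, v, hgt, hlt', h0.swap₁₂, Or.inr (Or.inl rfl)⟩
    · -- `v < u < x`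
      exact ⟨x, u, v, hvu, hgt', h0, Or.inl rfl⟩

/-- The `b`-invariants of `E/ℝ` are those of `E/ℚ`. [folklore] -/
theorem baseChange_real_b (W : WeierstrassCurve ℚ) :
    (W.baseChange ℝ).b₂ = (W.b₂ : ℝ) ∧ (W.baseChange ℝ).b₄ = (W.b₄ : ℝ) ∧
      (W.baseChange ℝ).b₆ = (W.b₆ : ℝ) := by
  simp only [WeierstrassCurve.baseChange, WeierstrassCurve.map_b₂, WeierstrassCurve.map_b₄,
    WeierstrassCurve.map_b₆, eq_ratCast, and_self]

/-- **For `E/ℚ` with a rational point of order `2` (abscissa `x`) and `Δ_E > 0`: three ordered real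
roots `e₁ > e₂ > e₃` of the `2`-division cubic, `x` among them.** [cite: SilvermanAEC2009, III.1 and Prop. X.1.4]
[cite: GreenbergLNM1716, §5 p. 168] -/
theorem exists_ordered_splitTwoTorsion_rat (W : WeierstrassCurve ℚ) {x : ℚ}
    (hx : HasRationalTwoTorsionX W x) (hΔ : 0 < W.Δ) :
    ∃ e₁ e₂ e₃ : ℝ, e₃ < e₂ ∧ e₂ < e₁ ∧ (W.baseChange ℝ).toAffine.SplitTwoTorsion e₁ e₂ e₃ ∧
      ((x : ℝ) = e₁ ∨ (x : ℝ) = e₂ ∨ (x : ℝ) = e₃) := by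
  obtain ⟨y, hxy, h2⟩ := hx
  obtain ⟨hb₂, hb₄, hb₆⟩ := baseChange_real_b W
  have hroot : 4 * (x : ℝ) ^ 3 + (W.baseChange ℝ).b₂ * (x : ℝ) ^ 2 +
      2 * (W.baseChange ℝ).b₄ * (x : ℝ) + (W.baseChange ℝ).b₆ = 0 := by
    rw [hb₂, hb₄, hb₆]
    exact fourXCubed_add_eq_zero_of_twoTorsion_real hxy h2
  have hΔR : 0 < (W.baseChange ℝ).Δ := by
    rw [WeierstrassCurve.baseChange, WeierstrassCurve.map_Δ, eq_ratCast]; exact_mod_cast hΔ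
  exact exists_ordered_splitTwoTorsion_real (W.baseChange ℝ) hroot hΔR

/-- **Greenberg's "odd" dictionary**: with `e₁ > e₂ > e₃` the real roots of the `2`-division cubic of
`E/ℚ` and `x ∈ {e₁, e₂, e₃}` rational, `TwoTorsionOdd W x` ("`x` is the least real root", i.e. the
rational point of order `2` generates `C_∞[2]`, LNM 1716 Remark p. 174) holds iff `x = e₃`.
[cite: GreenbergLNM1716, §5 p. 168 and Remark p. 174] -/
theorem twoTorsionOdd_iff_eq_e₃ (W : WeierstrassCurve ℚ) {x : ℚ} {e₁ e₂ e₃ : ℝ} (h₂₃ : e₃ < e₂)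
    (h₁₂ : e₂ < e₁) (h : (W.baseChange ℝ).toAffine.SplitTwoTorsion e₁ e₂ e₃)
    (hx : (x : ℝ) = e₁ ∨ (x : ℝ) = e₂ ∨ (x : ℝ) = e₃) : TwoTorsionOdd W x ↔ (x : ℝ) = e₃ := by
  obtain ⟨hb₂, hb₄, hb₆⟩ := baseChange_real_b W
  have hroots : ∀ r : ℝ, 4 * r ^ 3 + (W.b₂ : ℝ) * r ^ 2 + 2 * (W.b₄ : ℝ) * r + (W.b₆ : ℝ) = 0 ↔
      (r = e₁ ∨ r = e₂ ∨ r = e₃) := by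
    intro r
    rw [← hb₂, ← hb₄, ← hb₆]
    refine ⟨eq_or_eq_or_eq_of_root h, ?_⟩
    rintro (rfl | rfl | rfl)
    · exact root_of_splitTwoTorsion h.swap₂₃.swap₁₂.swap₂₃
    · exact root_of_splitTwoTorsion h.swap₂₃
    · exact root_of_splitTwoTorsion h
  rw [twoTorsionOdd_iff]
  constructor
  · intro hodd
    have h3 := hodd e₃ ((hroots e₃).mpr (Or.inr (Or.inr rfl)))
    rcases hx with hx | hx | hx
    · rw [hx] at h3; linarith
    · rw [hx] at h3; linarith
    · exact hx
  · intro hx3 r hr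
    rw [hx3]
    rcases (hroots r).mp hr with rfl | rfl | rfl <;> linarith

end RealRoots

/-! ## §3. Transport to the completion `ℚ_w ≅ ℝ` and real halving in `E(ℚ_w)` -/

section Completion

variable (W : WeierstrassCurve ℚ) [W.IsElliptic] (w : InfinitePlace ℚ)

/-- Every positive real number is a square (input `hsq` of file III). [folklore] -/
theorem real_pos_isSq : ∀ a : ℝ, 0 < a → ∃ u : ℝ, a = u ^ 2 :=
  fun a ha ↦ ⟨Real.sqrt a, (Real.sq_sqrt ha.le).symm⟩

/-- **Three ordered roots in `ℚ_w`, a square root of `(e₃−e₁)(e₃−e₂)`, the abscissa dictionary, and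
real halving in `E(ℚ_w)`.** For `E/ℚ` with a rational point of order `2` (abscissa `x`) and `Δ_E > 0`,
at the infinite place `w` (`ℚ_w = w.Completion ≅ ℝ`): there are `e₁ e₂ e₃ ∈ ℚ_w` with
`SplitTwoTorsion (E/ℚ_w) e₁ e₂ e₃` (ordered `e₁ > e₂ > e₃` in `ℝ`), `x ∈ {e₁, e₂, e₃}` with
`TwoTorsionOdd W x ↔ x = e₃`, an `s ∈ ℚ_w` with `s² = (e₃ − e₁)(e₃ − e₂)`, every `P ∈ E(ℚ_w)` is `2ᵏQ` or
`2ᵏQ + T₃` (`T₃ = (e₃, ·)`), and `T₃ ∉ 2E(ℚ_w)` — file III read through `E(ℚ_w) ≅ E(ℝ)`.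
[cite: SilvermanAEC2009, Prop. X.1.4] [cite: MilneADT2006, I Rem. 3.7]
[cite: GreenbergLNM1716, §5 Remark p. 174] -/
theorem exists_ordered_splitTwoTorsion_completion {x : ℚ} (hx : HasRationalTwoTorsionX W x)
    (hΔ : 0 < W.Δ) :
    ∃ e₁ e₂ e₃ : w.Completion, (W.baseChange w.Completion).toAffine.SplitTwoTorsion e₁ e₂ e₃ ∧
      e₁ ≠ e₂ ∧ e₁ ≠ e₃ ∧ e₂ ≠ e₃ ∧
      ((x : w.Completion) = e₁ ∨ (x : w.Completion) = e₂ ∨ (x : w.Completion) = e₃) ∧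
      (TwoTorsionOdd W x ↔ (x : w.Completion) = e₃) ∧
      (∃ s : w.Completion, (e₃ - e₁) * (e₃ - e₂) = s ^ 2) ∧
      (∀ h₃ : (W.baseChange w.Completion).toAffine.Nonsingular e₃
          ((W.baseChange w.Completion).toAffine.twoTorsionY e₃),
        (∀ (k : ℕ) (P : (W.baseChange w.Completion).toAffine.Point),
          ∃ Q : (W.baseChange w.Completion).toAffine.Point,
            (2 ^ k) • Q = P ∨ (2 ^ k) • Q = P + .some e₃ _ h₃) ∧
        ∀ Q : (W.baseChange w.Completion).toAffine.Point, Q + Q ≠ .some e₃ _ h₃) := by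
  have hw : w.IsReal := IsTotallyReal.isReal w
  set f : w.Completion ≃+* ℝ := InfinitePlace.Completion.ringEquivRealOfIsReal hw with hf
  have hfq : ∀ q : ℚ, f (q : w.Completion) = (q : ℝ) := fun q ↦ map_ratCast f q
  obtain ⟨r₁, r₂, r₃, h₂₃, h₁₂, hsplit, hxr⟩ := exists_ordered_splitTwoTorsion_rat W hx hΔ
  -- the `b`-invariants of `E/ℚ_w` read in `ℝ`
  have hb₂ : f (W.baseChange w.Completion).b₂ = (W.baseChange ℝ).b₂ := by
    simp only [WeierstrassCurve.baseChange, WeierstrassCurve.map_b₂, eq_ratCast, hfq]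
  have hb₄ : f (W.baseChange w.Completion).b₄ = (W.baseChange ℝ).b₄ := by
    simp only [WeierstrassCurve.baseChange, WeierstrassCurve.map_b₄, eq_ratCast, hfq]
  have hb₆ : f (W.baseChange w.Completion).b₆ = (W.baseChange ℝ).b₆ := by
    simp only [WeierstrassCurve.baseChange, WeierstrassCurve.map_b₆, eq_ratCast, hfq]
  have ha₁ : f (W.baseChange w.Completion).a₁ = (W.baseChange ℝ).a₁ := by
    simp only [WeierstrassCurve.baseChange, WeierstrassCurve.map_a₁, eq_ratCast, hfq]
  have ha₃ : f (W.baseChange w.Completion).a₃ = (W.baseChange ℝ).a₃ := by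
    simp only [WeierstrassCurve.baseChange, WeierstrassCurve.map_a₃, eq_ratCast, hfq]
  set e₁ := f.symm r₁ with he₁
  set e₂ := f.symm r₂ with he₂
  set e₃ := f.symm r₃ with he₃
  have hfe₁ : f e₁ = r₁ := f.apply_symm_apply r₁
  have hfe₂ : f e₂ = r₂ := f.apply_symm_apply r₂
  have hfe₃ : f e₃ = r₃ := f.apply_symm_apply r₃
  have hsplitw : (W.baseChange w.Completion).toAffine.SplitTwoTorsion e₁ e₂ e₃ := by
    refine ⟨f.injective ?_, f.injective ?_, f.injective ?_⟩
    · change f (W.baseChange w.Completion).b₂ = _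
      rw [hb₂, hsplit.b₂_eq]; simp [map_ofNat, hfe₁, hfe₂, hfe₃]
    · change f (W.baseChange w.Completion).b₄ = _
      rw [hb₄, hsplit.b₄_eq]; simp [map_ofNat, hfe₁, hfe₂, hfe₃]
    · change f (W.baseChange w.Completion).b₆ = _
      rw [hb₆, hsplit.b₆_eq]; simp [map_ofNat, hfe₁, hfe₂, hfe₃]
  have hxe : (x : w.Completion) = e₁ ∨ (x : w.Completion) = e₂ ∨ (x : w.Completion) = e₃ := by
    rcases hxr with h | h | h
    · exact Or.inl (f.injective (by rw [hfq, hfe₁, h]))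
    · exact Or.inr (Or.inl (f.injective (by rw [hfq, hfe₂, h])))
    · exact Or.inr (Or.inr (f.injective (by rw [hfq, hfe₃, h])))
  refine ⟨e₁, e₂, e₃, hsplitw, fun h ↦ by have := congrArg f h; rw [hfe₁, hfe₂] at this; linarith,
    fun h ↦ by have := congrArg f h; rw [hfe₁, hfe₃] at this; linarith,
    fun h ↦ by have := congrArg f h; rw [hfe₂, hfe₃] at this; linarith, hxe, ?_, ?_, ?_⟩
  · -- the dictionary
    rw [twoTorsionOdd_iff_eq_e₃ W h₂₃ h₁₂ hsplit hxr]
    constructor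
    · intro h; exact f.injective (by rw [hfq, hfe₃, h])
    · intro h; have := congrArg f h; rwa [hfq, hfe₃] at this
  · -- the square root
    have hpos : 0 < (r₃ - r₁) * (r₃ - r₂) := mul_pos_of_neg_of_neg (by linarith) (by linarith)
    refine ⟨f.symm (Real.sqrt ((r₃ - r₁) * (r₃ - r₂))), f.injective ?_⟩
    rw [map_pow, f.apply_symm_apply, Real.sq_sqrt hpos.le, map_mul, map_sub, map_sub, hfe₁, hfe₂, hfe₃]
  · -- real halving, transported along `E(ℚ_w) ≃ E(ℝ)`
    intro h₃
    have hfc : ∀ q : ℚ, f.toRingHom (algebraMap ℚ w.Completion q) = algebraMap ℚ ℝ q := fun q ↦ by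
      change f (algebraMap ℚ w.Completion q) = algebraMap ℚ ℝ q
      rw [eq_ratCast, eq_ratCast, hfq]
    let f' : w.Completion →ₐ[ℚ] ℝ := { f.toRingHom with commutes' := hfc }
    have hf' : ∀ z, f' z = f z := fun _ ↦ rfl
    set φ : (W.baseChange w.Completion).toAffine.Point →+ (W.baseChange ℝ).toAffine.Point :=
      Affine.Point.map f' with hφ
    have hφinj : Function.Injective φ := Affine.Point.map_injective (f := f')
    have hφsurj : Function.Surjective φ := by
      intro Q
      have hgc : ∀ q : ℚ, f.symm.toRingHom (algebraMap ℚ ℝ q) = algebraMap ℚ w.Completion q :=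
        fun q ↦ by
          change f.symm (algebraMap ℚ ℝ q) = algebraMap ℚ w.Completion q
          apply f.injective
          rw [f.apply_symm_apply, eq_ratCast, eq_ratCast, hfq]
      let g' : ℝ →ₐ[ℚ] w.Completion := { f.symm.toRingHom with commutes' := hgc }
      refine ⟨Affine.Point.map g' Q, ?_⟩
      rcases Q with _ | ⟨a, b, hab⟩
      · rfl
      · rw [hφ, Affine.Point.map_some, Affine.Point.map_some]
        simp only [Affine.Point.some.injEq]
        exact ⟨f.apply_symm_apply a, f.apply_symm_apply b⟩
    have h₃R : (W.baseChange ℝ).toAffine.Nonsingular r₃ ((W.baseChange ℝ).toAffine.twoTorsionY r₃) :=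
      nonsingular_twoTorsion hsplit.swap₂₃.swap₁₂
    have hφT : φ (.some e₃ _ h₃) = .some r₃ _ h₃R := by
      rw [hφ, Affine.Point.map_some]
      simp only [Affine.Point.some.injEq]
      refine ⟨by rw [hf', hfe₃], ?_⟩
      rw [hf']
      change f (-((W.baseChange w.Completion).a₁ * e₃ + (W.baseChange w.Completion).a₃) / 2) =
        -((W.baseChange ℝ).a₁ * r₃ + (W.baseChange ℝ).a₃) / 2
      rw [map_div₀, map_neg, map_add, map_mul, ha₁, ha₃, hfe₃, map_ofNat]
    constructor
    · intro k P
      obtain ⟨Q', hQ'⟩ := exists_pow_smul_eq_or hsplit h₁₂ h₂₃ real_pos_isSq k (φ P)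
      obtain ⟨Q, rfl⟩ := hφsurj Q'
      refine ⟨Q, ?_⟩
      rcases hQ' with hQ' | hQ'
      · left; exact hφinj (by rw [map_nsmul]; exact hQ')
      · right
        apply hφinj
        rw [map_nsmul, map_add, hφT]
        convert hQ' using 2
    · intro Q hQ
      have h := congrArg φ hQ
      rw [map_add, hφT] at h
      exact ne_add_self_T₃ hsplit h₂₃ (φ Q) (by convert h using 1)

end Completion

end Summit.BirchSwinnertonDyer.BirchSwinnertonDyer.Theorems.MultTransportAtTwo

end
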